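import Mathlib
import Summits.ResolutionOfSingularities.ResolutionOfSingularities.Theorems.RadicialJungCleanModelsCleanLU3CompositeDownstairsCasesPrelims
import HarnessLib

/-!
# Route `RadicialJung`, crux `CleanModels` (stmt-15917), stub `stub_cleanLU3DefectNonDiscrete`, sub-line (C-div): the DOWNSTAIRS ASSEMBLY
# over the PERSIST stubs of workfile v3 (`stub_persistCases`, `stub_persistE1`, `stub_persistE2`)

Line `Sketch` rev 24 of crux stmt-ResolutionOfSingularities-15917; lead `res-B-lead-1` g4 (workfile `Lines/Sketch_Cdiv_assembly.lean` v3).  OURS;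
nothing here proves resolution in characteristic `p`.

Workfile v3 withdraws the one-step persistence stub `stub_persistStep` (v2.1: coefficient integrality and clean form read in ONE regular system of
parameters — suspected false) and replaces it by `stub_persistCases` (integrality r.s.p. `(x, y)` and clean-form r.s.p. `(x₁, y₁)` DECOUPLED;
input of form (1) or (2) only; the two «first-order» facts of the step as hypotheses), `stub_persistE1` (a unit `ε (y₁/x₁)^b`, `p ∤ b`, is a
`p`-th power at most to first order after the transform) and `stub_persistE2` (a unit with residue outside `κ(S)^p` likewise, given that every
non-`p`-th power of `κ(S)` is moved by a derivation).  `exists_cleanMono_stage_of_cases` re-proves ✓ `exists_cleanMono_stage'`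
(`…CompositeDownstairsDom.lean`) — SAME conclusion (the denominator LIST of the conclusion already separates the two r.s.p.'s) — from `hLU2` and
these three hypotheses: the induction from the clean stage `N` (D2 + Abhyankar) to the monomial stage `M` (✓ MONO) carries the decoupled
invariant; form (3) is normalised to form (1) before each step (`form_one_or_two_of_form`: `s − γ^p = z ∈ 𝔪 ∖ 𝔪²` is `z¹·z₂⁰` in an r.s.p.
`(z, z₂)`, `exists_span_pair_of_not_mem_sq`, shifting `c₀` by `γ`); the derivation hypothesis of E2 is discharged at every stage from ✓ D-abs
(`Lens5.AbsDerivation.absDerivation_of_forall_pow_ne'`) on the residue field of the stage, a field finitely generated over `k`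
(`exists_derivation_residueField_of_model`; the three preliminaries live in `…CompositeDownstairsCasesPrelims.lean`).
-/

noncomputable section

set_option linter.dupNamespace false -- mandated namespace of this single-conjunct summit

open IsLocalRing AlgebraicGeometry CategoryTheory
open Literature.AlgebraicGeometry.Resolution

namespace Summit.ResolutionOfSingularities.ResolutionOfSingularities.Theorems.RadicialJung.CleanModels

variable {κ : Type} [Field κ] {k : Type} [Field k] [Algebra k κ]

/-- **The downstairs assembly over the PERSIST stubs of workfile v3.**  Same statement as ✓ `exists_cleanMono_stage'` with the one-step
hypothesis `hpersist` replaced by `hCases`, `hE1`, `hE2` (the shapes of `stub_persistCases`, `stub_persistE1`, `stub_persistE2`).  See the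
module docstring. [folklore] -/
theorem exists_cleanMono_stage_of_cases
    (hEmb : ∀ (Z : Scheme.{0}) [IsIntegral Z] [IsNoetherian Z], Scheme.IsRegular Z →
      Scheme.IsExcellent Z → ∀ (X : Set Z), IsClosed X → X ≠ Set.univ → topologicalKrullDim X ≤ 2 →
        ∃ (Z' : Scheme.{0}) (π : Z' ⟶ Z), IsProper π ∧ Function.Surjective π.base ∧
          (∃ U : Z.Opens, (U : Set Z) = Xᶜ ∧ IsIso (π ∣_ U)) ∧
          IsStrictNormalCrossingsDivisor Z' (π.base ⁻¹' X))
    (p : ℕ) [hp : Fact p.Prime] [CharP κ p] [CharP k p]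
    (hLU2 : ∀ (Ō : ValuationSubring κ) (Ā : Subalgebra k κ), Ā.toSubring ≤ Ō.toSubring → Ā.FG → IsFractionRing Ā κ →
      IsRegularLocalRing (locAtCentre Ā.toSubring Ō) →
      ringKrullDim (locAtCentre Ā.toSubring Ō) = 2 →
      (∀ (T : Subring κ) (hT : T ≤ Ō.toSubring), Ā.toSubring ≤ T → (subringCentre T Ō hT).IsMaximal) →
      ∀ ū : κ, (∀ c : κ, c ^ p ≠ ū) →
      ∃ (Ā' : Subalgebra k κ), Ā'.toSubring ≤ Ō.toSubring ∧ Ā ≤ Ā' ∧ Ā'.FG ∧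
      ∃ (_ : IsRegularLocalRing (locAtCentre Ā'.toSubring Ō)) (c : Fin p → κ), (∃ j : Fin p, (j : ℕ) ≠ 0 ∧ c j ≠ 0) ∧
      ((∃ (d m : ℕ) (hmd : m ≤ d) (t : Fin d → ↥(locAtCentre Ā'.toSubring Ō)) (a : Fin m → ℕ) (u : ↥(locAtCentre Ā'.toSubring Ō)), IsUnit u ∧
      Ideal.span (Set.range t) = IsLocalRing.maximalIdeal ↥(locAtCentre Ā'.toSubring Ō) ∧
      ringKrullDim ↥(locAtCentre Ā'.toSubring Ō) = (d : WithBot ℕ∞) ∧ 0 < m ∧ (∀ i, ¬ p ∣ a i) ∧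
      (∑ j : Fin p, c j ^ p * ū ^ (j : ℕ)) = (u : κ) * ∏ i : Fin m, ((t (Fin.castLE hmd i) : ↥(locAtCentre Ā'.toSubring Ō)) : κ) ^ (a i)) ∨
      (∃ u : ↥(locAtCentre Ā'.toSubring Ō), IsUnit u ∧ (∑ j : Fin p, c j ^ p * ū ^ (j : ℕ)) = (u : κ) ∧
      ∀ c' : ↥(locAtCentre Ā'.toSubring Ō), u - c' ^ p ∉ IsLocalRing.maximalIdeal ↥(locAtCentre Ā'.toSubring Ō)) ∨
      (∃ s c' : ↥(locAtCentre Ā'.toSubring Ō), (∑ j : Fin p, c j ^ p * ū ^ (j : ℕ)) = (s : κ) ∧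
      s - c' ^ p ∈ IsLocalRing.maximalIdeal ↥(locAtCentre Ā'.toSubring Ō) ∧
      s - c' ^ p ∉ IsLocalRing.maximalIdeal ↥(locAtCentre Ā'.toSubring Ō) ^ 2)))
    (hCases : ∀ (Ō : ValuationSubring κ) (S S' : Subring κ) [IsRegularLocalRing S] [IsRegularLocalRing S'],
      ringKrullDim S = 2 → ringKrullDim S' = 2 → IsLocalRingOf S → IsQuadraticTransformAlong Ō S S' →
      SubringDominates S Ō.toSubring →
      (∀ (x₁ y₁ : S), maximalIdeal S = Ideal.span {x₁, y₁} → ∀ (ε : S), IsUnit ε → ∀ (b : ℕ), ¬ p ∣ b →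
        ∀ (θ : S'), IsUnit θ → (θ : κ) * (x₁ : κ) ^ b = (ε : κ) * (y₁ : κ) ^ b →
        ∀ γ : S', θ - γ ^ p ∉ maximalIdeal S' ^ 2) →
      (∀ (ε : S), (∀ b : S, ε - b ^ p ∉ maximalIdeal S) → ∀ (θ : S'), (θ : κ) = (ε : κ) →
        ∀ γ : S', θ - γ ^ p ∉ maximalIdeal S' ^ 2) →
      ∀ (ū d : κ), d ∈ S → d ≠ 0 →
      ∀ (c : Fin p → κ), (∃ j : Fin p, (j : ℕ) ≠ 0 ∧ c j ≠ 0) →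
      ∀ (x y : S), maximalIdeal S = Ideal.span {x, y} →
      ∀ (α β : ℕ), (∀ j : Fin p, c j * d * (x : κ) ^ α * (y : κ) ^ β ∈ S) →
      ((∃ (x₁ y₁ : S), maximalIdeal S = Ideal.span {x₁, y₁} ∧ ∃ (a b : ℕ) (ε : S), IsUnit ε ∧ (a ≠ 0 ∨ b ≠ 0) ∧
          (a = 0 ∨ ¬ p ∣ a) ∧ (b = 0 ∨ ¬ p ∣ b) ∧
          (∑ j : Fin p, c j ^ p * ū ^ (j : ℕ)) = (ε : κ) * (x₁ : κ) ^ a * (y₁ : κ) ^ b) ∨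
        (∃ u : S, IsUnit u ∧ (∑ j : Fin p, c j ^ p * ū ^ (j : ℕ)) = (u : κ) ∧ ∀ c' : S, u - c' ^ p ∉ maximalIdeal S)) →
      ∃ (c' : Fin p → κ), (∃ j : Fin p, (j : ℕ) ≠ 0 ∧ c' j ≠ 0) ∧
      ∃ (x' y' : S'), maximalIdeal S' = Ideal.span {x', y'} ∧
      ∃ (α' β' : ℕ), (∀ j : Fin p, c' j * d * (x' : κ) ^ α' * (y' : κ) ^ β' ∈ S') ∧
      ((∃ (x₁ y₁ : S'), maximalIdeal S' = Ideal.span {x₁, y₁} ∧ ∃ (a b : ℕ) (ε : S'), IsUnit ε ∧ (a ≠ 0 ∨ b ≠ 0) ∧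
          (a = 0 ∨ ¬ p ∣ a) ∧ (b = 0 ∨ ¬ p ∣ b) ∧
          (∑ j : Fin p, c' j ^ p * ū ^ (j : ℕ)) = (ε : κ) * (x₁ : κ) ^ a * (y₁ : κ) ^ b) ∨
        (∃ u : S', IsUnit u ∧ (∑ j : Fin p, c' j ^ p * ū ^ (j : ℕ)) = (u : κ) ∧ ∀ c'' : S', u - c'' ^ p ∉ maximalIdeal S') ∨
        (∃ s c'' : S', (∑ j : Fin p, c' j ^ p * ū ^ (j : ℕ)) = (s : κ) ∧ s - c'' ^ p ∈ maximalIdeal S' ∧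
          s - c'' ^ p ∉ maximalIdeal S' ^ 2)))
    (hE1 : ∀ (Ō : ValuationSubring κ) (S S' : Subring κ) [IsRegularLocalRing S] [IsRegularLocalRing S'],
      ringKrullDim S = 2 → ringKrullDim S' = 2 → IsLocalRingOf S → IsQuadraticTransformAlong Ō S S' →
      SubringDominates S Ō.toSubring →
      ∀ (x₁ y₁ : S), maximalIdeal S = Ideal.span {x₁, y₁} →
      ∀ (ε : S), IsUnit ε → ∀ (b : ℕ), ¬ p ∣ b →
      ∀ (θ : S'), IsUnit θ → (θ : κ) * (x₁ : κ) ^ b = (ε : κ) * (y₁ : κ) ^ b →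
      ∀ γ : S', θ - γ ^ p ∉ maximalIdeal S' ^ 2)
    (hE2 : ∀ (Ō : ValuationSubring κ) (S S' : Subring κ) [IsRegularLocalRing S] [IsRegularLocalRing S'],
      ringKrullDim S = 2 → ringKrullDim S' = 2 → IsLocalRingOf S → IsQuadraticTransformAlong Ō S S' →
      SubringDominates S Ō.toSubring →
      (∀ a : ResidueField S, (∀ b : ResidueField S, b ^ p ≠ a) →
        ∃ D : Derivation ℤ (ResidueField S) (ResidueField S), D a ≠ 0) →
      ∀ (ε : S), (∀ b : S, ε - b ^ p ∉ maximalIdeal S) →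
      ∀ (θ : S'), (θ : κ) = (ε : κ) →
      ∀ γ : S', θ - γ ^ p ∉ maximalIdeal S' ^ 2)
    (Ō : ValuationSubring κ) (Ā : Subalgebra k κ) (hĀŌ : Ā.toSubring ≤ Ō.toSubring) (hĀfg : Ā.FG) [IsFractionRing Ā κ]
    (hreg : IsRegularLocalRing (locAtCentre Ā.toSubring Ō)) (hdim2 : ringKrullDim (locAtCentre Ā.toSubring Ō) = 2)
    (hzd : ∀ (T : Subring κ) (hT : T ≤ Ō.toSubring), Ā.toSubring ≤ T → (subringCentre T Ō hT).IsMaximal)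
    (ū : κ) (hū : ∀ c : κ, c ^ p ≠ ū) :
    ∃ (Rb : ℕ → Subring κ), Rb 0 = locAtCentre Ā.toSubring Ō ∧ (∀ i, IsQuadraticTransformAlong Ō (Rb i) (Rb (i + 1))) ∧
      ∃ (M : ℕ) (_ : IsRegularLocalRing (Rb M)), ringKrullDim (Rb M) = 2 ∧
      ∃ (c : Fin p → κ), (∃ j : Fin p, (j : ℕ) ≠ 0 ∧ c j ≠ 0) ∧
      ∃ (xb yb : Rb M), (xb : κ) ≠ 0 ∧ (yb : κ) ≠ 0 ∧ maximalIdeal (Rb M) = Ideal.span {xb, yb} ∧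
      ∃ (Lb : List (κ × κ × ℕ)),
        (∀ t ∈ Lb, t.1 ≠ 0 ∧ ∃ (h₁ : t.1 ∈ Rb M) (h₂ : t.2.1 ∈ Rb M), maximalIdeal (Rb M) = Ideal.span {⟨_, h₁⟩, ⟨_, h₂⟩}) ∧
        (∀ j : Fin p, c j * (Lb.map fun t => t.1 ^ t.2.2).prod ∈ Rb M) ∧
        ((∃ (a b : ℕ) (ε : Rb M), IsUnit ε ∧ (a ≠ 0 ∨ b ≠ 0) ∧ (a = 0 ∨ ¬ p ∣ a) ∧ (b = 0 ∨ ¬ p ∣ b) ∧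
            (∑ j : Fin p, c j ^ p * ū ^ (j : ℕ)) = (ε : κ) * (xb : κ) ^ a * (yb : κ) ^ b) ∨
          (∃ w : Rb M, IsUnit w ∧ (∑ j : Fin p, c j ^ p * ū ^ (j : ℕ)) = (w : κ) ∧ ∀ c' : Rb M, w - c' ^ p ∉ maximalIdeal (Rb M)) ∨
          (∃ s c' : Rb M, (∑ j : Fin p, c j ^ p * ū ^ (j : ℕ)) = (s : κ) ∧ s - c' ^ p ∈ maximalIdeal (Rb M) ∧
            s - c' ^ p ∉ maximalIdeal (Rb M) ^ 2)) := by
  classical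
  have hp0 : p ≠ 0 := hp.out.ne_zero
  -- the quadratic sequence of the residue surface
  have hd0 : ringKrullDim (locAtCentre Ā.toSubring Ō) ≠ 0 := by rw [hdim2]; norm_num
  obtain ⟨Rb, hR0, hstep, hregR, hdimR', hmodel⟩ := exists_quadraticSeq_package Ā Ō hĀŌ hĀfg hreg hd0 hzd
  have hdimR : ∀ i, ringKrullDim (Rb i) = 2 := fun i => (hdimR' i).trans hdim2
  have hmono := sequence_monotone hstep
  have hdomseq := fun n => (sequence_dominates (R := Rb) (hR0 ▸ subringDominates_locAtCentre hĀŌ) hstep n)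
  have hdimĀ : ringKrullDim Ā = 2 := by
    rw [← ringKrullDim_locAtCentre_eq_of_isMaximal Ā hĀfg Ō hĀŌ (hzd _ hĀŌ le_rfl)]; exact hdim2
  have hof : ∀ i, IsLocalRingOf (Rb i) := by
    intro i
    obtain ⟨Āi, hĀiŌ, hĀĀi, -, hRi⟩ := hmodel i
    haveI := isFractionRing_of_le hĀĀi ‹IsFractionRing Ā κ›
    rw [hRi]; exact isLocalRingOf_locAtCentre Āi Ō hĀiŌ
  -- D2: clean local uniformization at some model `Ā'`
  obtain ⟨Ā', hĀ'Ō, hĀĀ', hĀ'fg, hreg', c₀, hc₀, hform⟩ := hLU2 Ō Ā hĀŌ hĀfg ‹_› hreg hdim2 hzd ū hū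
  have hdimS' : ringKrullDim (locAtCentre Ā'.toSubring Ō) = 2 := by
    rw [ringKrullDim_locAtCentre_eq_of_isMaximal Ā' hĀ'fg Ō hĀ'Ō (hzd _ hĀ'Ō (fun z hz => hĀĀ' hz)),
      ringKrullDim_eq_of_fg_of_le hĀfg hĀ'fg hĀĀ', hdimĀ]
  -- Abhyankar: `locAtCentre Ā' Ō = R̄_N`
  have hR0S : SubringDominates (Rb 0) (locAtCentre Ā'.toSubring Ō) :=
    (hdomseq 0).1.of_le_of_le (by rw [hR0]; exact locAtCentre_mono Ō (fun z hz => hĀĀ' hz)) (locAtCentre_le hĀ'Ō)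
  obtain ⟨N, hN⟩ := AbhyankarQuadraticFactorization_holds.exists_eq_of_dominated (R := Rb) (hregR 0) (hdimR 0) (hof 0) hstep
    hreg' hdimS' hR0S (subringDominates_locAtCentre hĀ'Ō)
  clear hdimS' hR0S
  revert hreg' hform
  rw [hN]
  intro hreg' hform
  haveI hregN := hregR N
  -- a default regular system of parameters of `R̄_N`, and the clean form in the DECOUPLED shape
  have hd2 : (maximalIdeal (Rb N)).spanFinrank = 2 := by
    have h := hregN.spanFinrank_maximalIdeal; rw [hdimR N] at h; exact_mod_cast h
  obtain ⟨x₀, hx₀⟩ := exists_regularSystemOfParameters (R := (Rb N))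
  let x' : Fin 2 → (Rb N) := fun i => x₀ (Fin.cast hd2.symm i)
  have hx' : maximalIdeal (Rb N) = Ideal.span {x' 0, x' 1} := by
    rw [← ideal_span_range_fin_two, ← hx₀]
    congr 1
    ext y
    simp only [Set.mem_range, x']
    constructor
    · rintro ⟨i, rfl⟩; exact ⟨Fin.cast hd2 i, congrArg x₀ (Fin.ext rfl)⟩
    · rintro ⟨i, rfl⟩; exact ⟨_, rfl⟩
  have hformN :
      (∃ (x₁ y₁ : Rb N), maximalIdeal (Rb N) = Ideal.span {x₁, y₁} ∧ ∃ (a b : ℕ) (ε : Rb N), IsUnit ε ∧ (a ≠ 0 ∨ b ≠ 0) ∧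
          (a = 0 ∨ ¬ p ∣ a) ∧ (b = 0 ∨ ¬ p ∣ b) ∧
          (∑ j : Fin p, c₀ j ^ p * ū ^ (j : ℕ)) = (ε : κ) * (x₁ : κ) ^ a * (y₁ : κ) ^ b) ∨
        (∃ u : Rb N, IsUnit u ∧ (∑ j : Fin p, c₀ j ^ p * ū ^ (j : ℕ)) = (u : κ) ∧ ∀ c' : Rb N, u - c' ^ p ∉ maximalIdeal (Rb N)) ∨
        (∃ s c' : Rb N, (∑ j : Fin p, c₀ j ^ p * ū ^ (j : ℕ)) = (s : κ) ∧ s - c' ^ p ∈ maximalIdeal (Rb N) ∧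
          s - c' ^ p ∉ maximalIdeal (Rb N) ^ 2) := by
    rcases hform with ⟨d, m, hmd, t, a, u, hu, hspan, hdimd, hm, ha, hG⟩ | ⟨u, hu, hG, hres⟩ | ⟨s, c', hG, h1, h2⟩
    · -- form (1): `d = 2`, `m ∈ {1, 2}`
      have hd : d = 2 := by have h := hdimd; rw [hdimR N] at h; exact_mod_cast h.symm
      subst hd
      refine Or.inl ⟨t 0, t 1, by rw [← ideal_span_range_fin_two, hspan], ?_⟩
      rcases Nat.lt_or_ge m 2 with hm1 | hm2
      · have hm1' : m = 1 := by omega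
        subst hm1'
        refine ⟨a 0, 0, u, hu, Or.inl (fun h => ha 0 (by rw [h]; exact dvd_zero p)), Or.inr (ha 0), Or.inl rfl, ?_⟩
        rw [hG, Fin.prod_univ_one, pow_zero, mul_one]
        rfl
      · have hm2' : m = 2 := le_antisymm hmd hm2
        subst hm2'
        refine ⟨a 0, a 1, u, hu, Or.inl (fun h => ha 0 (by rw [h]; exact dvd_zero p)), Or.inr (ha 0), Or.inr (ha 1), ?_⟩
        rw [hG, Fin.prod_univ_two, mul_assoc]
        rfl
    · exact Or.inr (Or.inl ⟨u, hu, hG, hres⟩)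
    · exact Or.inr (Or.inr ⟨s, c', hG, h1, h2⟩)
  -- a common denominator of the coefficients inside `Ā ⊆ R̄_N`
  have hden₀ : ∃ db : κ, db ∈ Ā ∧ db ≠ 0 ∧ ∀ j : Fin p, c₀ j * db ∈ Ā := by
    have hsingle : ∀ j : Fin p, ∃ b : κ, b ∈ Ā ∧ b ≠ 0 ∧ c₀ j * b ∈ Ā := by
      intro j
      obtain ⟨a, b, hb, hab⟩ := IsFractionRing.div_surjective (A := Ā) (c₀ j)
      have hb0 : (b : κ) ≠ 0 := by
        intro h
        have : (b : Ā) = 0 := Subtype.ext h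
        rw [this] at hb
        exact zero_notMem_nonZeroDivisors hb
      refine ⟨b, b.2, hb0, ?_⟩
      rw [← hab]
      change (a : κ) / (b : κ) * (b : κ) ∈ Ā
      rw [div_mul_cancel₀ _ hb0]; exact a.2
    choose b hb hb0 hcb using hsingle
    refine ⟨∏ j, b j, Subalgebra.prod_mem _ (fun j _ => hb j), Finset.prod_ne_zero_iff.mpr (fun j _ => hb0 j), fun j => ?_⟩
    rw [← Finset.mul_prod_erase _ _ (Finset.mem_univ j), ← mul_assoc]
    exact Subalgebra.mul_mem _ (hcb j) (Subalgebra.prod_mem _ (fun i _ => hb i))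
  obtain ⟨db, hdbĀ, hdb0, hcdb⟩ := hden₀
  have hĀN : Ā.toSubring ≤ Rb N := fun z hz => hN ▸ le_locAtCentre _ Ō (hĀĀ' hz)
  have hdbN : db ∈ Rb N := hĀN hdbĀ
  -- MONO: `db` becomes unit × monomial at some stage `M ≥ N`
  obtain ⟨M, hNM, z₁, z₂, ε, γ, δ, hε, hmaxM, hdbeq⟩ :=
    exists_stage_monomial hEmb Ō Ā hĀŌ hĀfg hzd hdim2 Rb hR0 hstep hregR hdimR hmodel N db hdbN hdb0
  -- PERSIST from `N` to `M`, with the DECOUPLED invariant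
  have hpers : ∀ m : ℕ, N ≤ m → m ≤ M →
      ∃ (c' : Fin p → κ), (∃ j : Fin p, (j : ℕ) ≠ 0 ∧ c' j ≠ 0) ∧
      ∃ (x' y' : Rb m), (haveI := (hregR m).toIsLocalRing; maximalIdeal (Rb m)) = Ideal.span {x', y'} ∧
      ∃ (α' β' : ℕ), (∀ j : Fin p, c' j * db * (x' : κ) ^ α' * (y' : κ) ^ β' ∈ Rb m) ∧
      (haveI := (hregR m).toIsLocalRing;
      ((∃ (x₁ y₁ : Rb m), maximalIdeal (Rb m) = Ideal.span {x₁, y₁} ∧ ∃ (a b : ℕ) (ε : Rb m), IsUnit ε ∧ (a ≠ 0 ∨ b ≠ 0) ∧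
          (a = 0 ∨ ¬ p ∣ a) ∧ (b = 0 ∨ ¬ p ∣ b) ∧
          (∑ j : Fin p, c' j ^ p * ū ^ (j : ℕ)) = (ε : κ) * (x₁ : κ) ^ a * (y₁ : κ) ^ b) ∨
        (∃ u : Rb m, IsUnit u ∧ (∑ j : Fin p, c' j ^ p * ū ^ (j : ℕ)) = (u : κ) ∧
          ∀ c'' : Rb m, u - c'' ^ p ∉ maximalIdeal (Rb m)) ∨
        (∃ s c'' : Rb m, (∑ j : Fin p, c' j ^ p * ū ^ (j : ℕ)) = (s : κ) ∧ s - c'' ^ p ∈ maximalIdeal (Rb m) ∧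
          s - c'' ^ p ∉ maximalIdeal (Rb m) ^ 2))) := by
    intro m hNm
    induction m, hNm using Nat.le_induction with
    | base =>
      intro _
      refine ⟨c₀, hc₀, x' 0, x' 1, hx', 0, 0, fun j => ?_, hformN⟩
      rw [pow_zero, pow_zero, mul_one, mul_one]
      exact hĀN (hcdb j)
    | succ m hNm ih =>
      intro hm
      obtain ⟨c', hc', x', y', hxy', α', β', hden', hform'⟩ := ih (by omega)
      haveI := hregR m
      haveI := hregR (m + 1)
      have hdbm : db ∈ Rb m := hmono hNm hdbN
      -- normalise form (3) to form (1)
      obtain ⟨c'', hc'', hden'', hform''⟩ := form_one_or_two_of_form p (Rb m) ū db hdbm c' hc' x' y' hxy' α' β' hden' hform'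
      -- the derivation hypothesis of E2 at the stage `m`
      obtain ⟨Ām, hĀmŌ, hĀĀm, hĀmfg, hRm⟩ := hmodel m
      have hDer : ∀ a : ResidueField (Rb m), (∀ b : ResidueField (Rb m), b ^ p ≠ a) →
          ∃ D : Derivation ℤ (ResidueField (Rb m)) (ResidueField (Rb m)), D a ≠ 0 := fun a ha =>
        exists_derivation_residueField_of_model p hp.out Ō Ām hĀmŌ hĀmfg (hzd _ hĀmŌ (fun z hz => hĀĀm hz)) (Rb m) hRm a ha
      obtain ⟨c₃, hc₃, x₃, y₃, hxy₃, α₃, β₃, hden₃, hform₃⟩ :=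
        hCases Ō (Rb m) (Rb (m + 1)) (hdimR _) (hdimR _) (hof _) (hstep _) (hdomseq m).1
          (hE1 Ō (Rb m) (Rb (m + 1)) (hdimR _) (hdimR _) (hof _) (hstep _) (hdomseq m).1)
          (hE2 Ō (Rb m) (Rb (m + 1)) (hdimR _) (hdimR _) (hof _) (hstep _) (hdomseq m).1 hDer)
          ū db hdbm hdb0 c'' hc'' x' y' hxy' α' β' hden'' hform''
      exact ⟨c₃, hc₃, x₃, y₃, hxy₃, α₃, β₃, hden₃, hform₃⟩
  obtain ⟨c, hc, x, y, hxyM, α, β, hdenM, hformM⟩ := hpers M hNM le_rfl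
  clear hpers
  haveI hRM := hregR M
  obtain ⟨hx0, hy0⟩ := ne_zero_of_rsop_two (Rb M) (hdimR _) x y hxyM
  obtain ⟨hz10, hz20⟩ := ne_zero_of_rsop_two (Rb M) (hdimR _) z₁ z₂ hmaxM
  -- the r.s.p. of the clean form: that of form (1), or the integrality one for forms (2)/(3)
  obtain ⟨xb, yb, hxbyb, hxb0, hyb0, hformb⟩ : ∃ xb yb : Rb M, maximalIdeal (Rb M) = Ideal.span {xb, yb} ∧
      (xb : κ) ≠ 0 ∧ (yb : κ) ≠ 0 ∧
      ((∃ (a b : ℕ) (ε : Rb M), IsUnit ε ∧ (a ≠ 0 ∨ b ≠ 0) ∧ (a = 0 ∨ ¬ p ∣ a) ∧ (b = 0 ∨ ¬ p ∣ b) ∧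
          (∑ j : Fin p, c j ^ p * ū ^ (j : ℕ)) = (ε : κ) * (xb : κ) ^ a * (yb : κ) ^ b) ∨
        (∃ w : Rb M, IsUnit w ∧ (∑ j : Fin p, c j ^ p * ū ^ (j : ℕ)) = (w : κ) ∧ ∀ c' : Rb M, w - c' ^ p ∉ maximalIdeal (Rb M)) ∨
        (∃ s c' : Rb M, (∑ j : Fin p, c j ^ p * ū ^ (j : ℕ)) = (s : κ) ∧ s - c' ^ p ∈ maximalIdeal (Rb M) ∧
          s - c' ^ p ∉ maximalIdeal (Rb M) ^ 2)) := by
    rcases hformM with ⟨x₁, y₁, hx₁y₁, hrest⟩ | h2 | h3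
    · obtain ⟨hx₁0, hy₁0⟩ := ne_zero_of_rsop_two (Rb M) (hdimR _) x₁ y₁ hx₁y₁
      exact ⟨x₁, y₁, hx₁y₁, hx₁0, hy₁0, Or.inl hrest⟩
    · exact ⟨x, y, hxyM, hx0, hy0, Or.inr (Or.inl h2)⟩
    · exact ⟨x, y, hxyM, hx0, hy0, Or.inr (Or.inr h3)⟩
  refine ⟨Rb, hR0, hstep, M, hRM, hdimR _, c, hc, xb, yb, hxb0, hyb0, hxbyb,
    [((z₁ : κ), (z₂ : κ), γ), ((z₂ : κ), (z₁ : κ), δ), ((x : κ), (y : κ), α), ((y : κ), (x : κ), β)], ?_, ?_, hformb⟩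
  · -- the denominators are regular parameters with partners
    intro t ht
    simp only [List.mem_cons, List.mem_nil_iff, or_false] at ht
    rcases ht with rfl | rfl | rfl | rfl
    · exact ⟨hz10, z₁.2, z₂.2, hmaxM⟩
    · exact ⟨hz20, z₂.2, z₁.2, hmaxM.trans (by rw [Set.pair_comm])⟩
    · exact ⟨hx0, x.2, y.2, hxyM⟩
    · exact ⟨hy0, y.2, x.2, hxyM.trans (by rw [Set.pair_comm])⟩
  · -- `c_j · z₁^γ z₂^δ x^α y^β ∈ R̄_M`, from `c_j · db · x^α y^β ∈ R̄_M` and `db = ε z₁^γ z₂^δ`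
    intro j
    simp only [List.map_cons, List.map_nil, List.prod_cons, List.prod_nil, mul_one]
    obtain ⟨e, he⟩ := hε
    have heinv : ((↑(e⁻¹ : (Rb (M))ˣ) : Rb (M)) : κ) * (ε : κ) = 1 := by
      rw [← he, ← Subring.coe_mul, Units.inv_mul, Subring.coe_one]
    have : c j * ((z₁ : κ) ^ γ * ((z₂ : κ) ^ δ * ((x : κ) ^ α * (y : κ) ^ β))) =
        (c j * db * (x : κ) ^ α * (y : κ) ^ β) * ((↑(e⁻¹ : (Rb (M))ˣ) : Rb (M)) : κ) := by
      rw [hdbeq]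
      have h1 := heinv
      linear_combination (-(c j * (z₁ : κ) ^ γ * (z₂ : κ) ^ δ * (x : κ) ^ α * (y : κ) ^ β)) * h1
    rw [this]
    exact Subring.mul_mem _ (hdenM j) (SetLike.coe_mem _)

end Summit.ResolutionOfSingularities.ResolutionOfSingularities.Theorems.RadicialJung.CleanModels

end
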